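import Summits.AtomisticToContinuum.FouriersLaw.Theorems.BondHeatUncertaintyLightConeBondHeatGibbsByParts
import Literature.MathematicalPhysics.KineticTheory.LangevinChainGibbs
import Literature.MathematicalPhysics.KineticTheory.LangevinChainSDE

/-!
# Integration by parts against `e^{-H/T}` for the `e^{θH}` growth class (Thomson bound, part A)

Helper file (`--supports stmt-AtomisticToContinuum-13512`, decl `HiddenChargeMazur.ThomsonBound`).
For the pinned anharmonic chain `pinnedChain ω₂ lam β γ` (`ω₂ > 0`, `lam, β ≥ 0`), `T > 0`, the
unnormalised Gibbs density `ρ = e^{-H/T}` (`OscillatorChain.gibbsDensity`) and the growth class of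
the item (`|u|, |∂u| ≤ C e^{θH}` with `θ < 1/(2T)`, possibly times a power of `1 + H`):

* `integrable_mul_gibbsDensity_of_le_exp`: a continuous `g = O((1+H)^m e^{ϑH})`, `ϑ < 1/T`, has
  `g ρ ∈ L¹(dq dp)` (domination by `e^{ϑ'H} e^{-H/T}`, `ϑ' = (ϑ + 1/T)/2`);
* `integral_mul_lineDeriv_mul_gibbsDensity`: the weighted integration by parts
  `∫ a (∂_v g) ρ = -∫ (∂_v a) g ρ + T⁻¹ ∫ (∂_v H) a g ρ` along a direction `v` of phase space, for
  `a = O((1+H)^m e^{θH})` (with its `v`-derivative) and `g = O(e^{θH})` (with its `v`-derivative),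
  `θ < 1/(2T)` — an instance of Mathlib's
  `integral_bilinear_hasLineDerivAt_right_eq_neg_left_of_integrable` (no compact support: all
  products are integrable);
* pointwise product bounds (`abs_mul_le_of_le_exp`, …) feeding the domination lemma.

The antisymmetry of the Liouville operator and the bath (Ornstein–Uhlenbeck) identity on this
class are in the companion files `…ThomsonBoundLiouville`, `…ThomsonBoundCutoff`.
-/

noncomputable section

open MeasureTheory

namespace Summit.AtomisticToContinuum.FouriersLaw.Theorems.ThomsonBound

open Literature.MathematicalPhysics.KineticTheory.HeatConduction
open Summit.AtomisticToContinuum.FouriersLaw.Theorems.LightConeBondHeat (one_add_pow_le_exp)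
open Summit.AtomisticToContinuum.FouriersLaw.Theorems.SubdiffusiveBondHeat
  (integral_mul_eq_neg_of_hasLineDerivAt_of_integrable)

variable {N : ℕ}

/-! ### Generic tools

Mathlib's line-derivative integration by parts under integrability hypotheses
(`SubdiffusiveBondHeat.integral_mul_eq_neg_of_hasLineDerivAt_of_integrable`) and the elementary
`(1+t)^m ≤ K e^{st}` (`LightConeBondHeat.one_add_pow_le_exp`) are reused from the tree. -/

/-- `e^{θ x} e^{θ x} = e^{2θ x}`. [folklore] -/
theorem exp_mul_self_eq (θ x : ℝ) : Real.exp (θ * x) * Real.exp (θ * x) = Real.exp (2 * θ * x) := by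
  rw [← Real.exp_add]; ring_nf

/-- Product bound: `|a g| ≤ A C (1+H)^m e^{2θH}` from `|a| ≤ A (1+H)^m e^{θH}`, `|g| ≤ C e^{θH}`.
[folklore] -/
theorem abs_mul_le_of_le_exp {a g H A C θ : ℝ} {m : ℕ}
    (ha : |a| ≤ A * (1 + H) ^ m * Real.exp (θ * H)) (hg : |g| ≤ C * Real.exp (θ * H)) :
    |a * g| ≤ A * C * (1 + H) ^ m * Real.exp (2 * θ * H) := by
  rw [abs_mul]
  calc |a| * |g| ≤ (A * (1 + H) ^ m * Real.exp (θ * H)) * (C * Real.exp (θ * H)) :=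
        mul_le_mul ha hg (abs_nonneg _) ((abs_nonneg _).trans ha)
    _ = A * C * (1 + H) ^ m * Real.exp (2 * θ * H) := by rw [← exp_mul_self_eq]; ring

/-- Product bound with a polynomial weight: `|D a g| ≤ A_D A C (1+H)^{m_D+m} e^{2θH}`. [folklore] -/
theorem abs_mul_mul_le_of_le_exp {D a g H AD A C θ : ℝ} {mD m : ℕ}
    (hD : |D| ≤ AD * (1 + H) ^ mD)
    (ha : |a| ≤ A * (1 + H) ^ m * Real.exp (θ * H)) (hg : |g| ≤ C * Real.exp (θ * H)) :
    |D * a * g| ≤ AD * A * C * (1 + H) ^ (mD + m) * Real.exp (2 * θ * H) := by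
  have h1 := abs_mul_le_of_le_exp ha hg
  rw [mul_assoc, abs_mul]
  calc |D| * |a * g| ≤ (AD * (1 + H) ^ mD) * (A * C * (1 + H) ^ m * Real.exp (2 * θ * H)) :=
        mul_le_mul hD h1 (abs_nonneg _) ((abs_nonneg _).trans hD)
    _ = AD * A * C * (1 + H) ^ (mD + m) * Real.exp (2 * θ * H) := by rw [pow_add]; ring

/-- Line derivative of a product `w · g` along `v` when the weight `w` is constant along `v`:
`∂_v (w g) = w ∂_v g`. [folklore] -/
theorem hasLineDerivAt_const_weight_mul {w g : PhaseSpace N → ℝ} {g' : ℝ} {x v : PhaseSpace N}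
    (hw : ∀ t : ℝ, w (x + t • v) = w x) (hg : HasLineDerivAt ℝ g g' x v) :
    HasLineDerivAt ℝ (fun y => w y * g y) (w x * g') x v := by
  unfold HasLineDerivAt at hg ⊢
  have h : (fun t : ℝ => (fun y => w y * g y) (x + t • v)) = fun t => w x * g (x + t • v) := by
    funext t
    simp only [hw t]
  rw [h]
  exact hg.const_mul (w x)

/-- Line derivative of a product: `∂_v (f g) = (∂_v f) g + f (∂_v g)`. [folklore] -/
theorem hasLineDerivAt_mul {f g : PhaseSpace N → ℝ} {f' g' : ℝ} {x v : PhaseSpace N}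
    (hf : HasLineDerivAt ℝ f f' x v) (hg : HasLineDerivAt ℝ g g' x v) :
    HasLineDerivAt ℝ (fun y => f y * g y) (f' * g x + f x * g') x v := by
  unfold HasLineDerivAt at hf hg ⊢
  have h := hf.mul hg
  simp only [zero_smul, add_zero] at h
  exact h

section Pinned

variable {ω₂ lam β : ℝ}

/-! ### Domination: `(1+H)^m e^{ϑH} e^{-H/T} ∈ L¹` for `ϑ < 1/T` -/

/-- `|p_b| ≤ 1 + H`. [folklore] -/
theorem abs_momentum_le_one_add (hl : 0 ≤ lam) (hβ : 0 ≤ β) (γ : ℝ) (N : ℕ) (x : PhaseSpace N)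
    (b : Fin N) (hω : 0 ≤ ω₂) :
    |x.2 b| ≤ 1 * (1 + (pinnedChain ω₂ lam β γ).hamiltonian N x) ^ 1 := by
  have h := pinnedChain_harmonic_le_hamiltonian (ω₂ := ω₂) hl hβ γ N x
  have h1 : x.2 b ^ 2 / 2 ≤ ∑ j, x.2 j ^ 2 / 2 :=
    Finset.single_le_sum (f := fun j => x.2 j ^ 2 / 2) (fun _ _ => by positivity) (Finset.mem_univ b)
  have h2 : 0 ≤ ∑ j, ω₂ * x.1 j ^ 2 / 2 := Finset.sum_nonneg fun _ _ => by positivity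
  have h3 := abs_le_half_add_sq_half (x.2 b)
  rw [one_mul, pow_one]
  linarith

/-- `|∂_{q_i} H| ≤ C_N (1 + H)` with `C_N = N (ω₂/2 + 3 + lam/ω₂ + N²(3+β))`. [folklore] -/
theorem abs_partialQ_hamiltonian_le (hω : 0 < ω₂) (hl : 0 ≤ lam) (hβ : 0 ≤ β) (γ : ℝ) (N : ℕ)
    (x : PhaseSpace N) (i : Fin N) :
    |partialQ i ((pinnedChain ω₂ lam β γ).hamiltonian N) x| ≤
      N * (ω₂ / 2 + 3 + lam / ω₂ + N ^ 2 * (3 + β)) *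
        (1 + (pinnedChain ω₂ lam β γ).hamiltonian N x) ^ 1 := by
  rw [pow_one]
  exact (Finset.single_le_sum
    (f := fun j => |partialQ j ((pinnedChain ω₂ lam β γ).hamiltonian N) x|)
    (fun _ _ => abs_nonneg _) (Finset.mem_univ i)).trans
    (pinnedChain_sum_abs_partialQ_le hω hl hβ γ N x)

/-- **Domination.** A continuous observable with `|g| ≤ C (1 + H)^m e^{ϑH}`, `ϑ < 1/T`, is
integrable against `e^{-H/T}` (pinned chain, `ω₂ > 0`, `lam, β ≥ 0`, `T > 0`):
`(1+H)^m ≤ K e^{sH}` with `s = (1/T - ϑ)/2` and `e^{(ϑ+s)H} e^{-H/T} ∈ L¹`. [folklore] -/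
theorem integrable_mul_gibbsDensity_of_le_exp (hω : 0 < ω₂) (hl : 0 ≤ lam) (hβ : 0 ≤ β) (γ : ℝ)
    (N : ℕ) {T ϑ : ℝ} (hT : 0 < T) (hϑ : ϑ < 1 / T) (m : ℕ) {g : PhaseSpace N → ℝ}
    (hg : Continuous g) {C : ℝ}
    (hle : ∀ x, |g x| ≤ C * (1 + (pinnedChain ω₂ lam β γ).hamiltonian N x) ^ m *
      Real.exp (ϑ * (pinnedChain ω₂ lam β γ).hamiltonian N x)) :
    Integrable fun x => g x * (pinnedChain ω₂ lam β γ).gibbsDensity N T x := by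
  set P := pinnedChain ω₂ lam β γ with hP
  set s : ℝ := (1 / T - ϑ) / 2 with hs_def
  have hs : 0 < s := by rw [hs_def]; linarith
  have hϑ' : ϑ + s < 1 / T := by rw [hs_def]; linarith
  set K : ℝ := m.factorial * Real.exp s / s ^ m with hK
  have hK0 : 0 ≤ K := by positivity
  have hmaj := (pinnedChain_integrable_exp_mul_gibbsDensity hω hl hβ γ N hT hϑ').const_mul (|C| * K)
  refine hmaj.mono' ((hg.mul (pinnedChain_continuous_gibbsDensity ω₂ lam β γ N T)).aestronglyMeasurable)
    (Filter.Eventually.of_forall fun x => ?_)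
  have hH0 : 0 ≤ P.hamiltonian N x := pinnedChain_hamiltonian_nonneg hω.le hl hβ γ N x
  have hρ : 0 < P.gibbsDensity N T x := P.gibbsDensity_pos N T x
  have hpow := one_add_pow_le_exp m hH0 hs
  have he : 0 < Real.exp (ϑ * P.hamiltonian N x) := Real.exp_pos _
  rw [Real.norm_eq_abs, abs_mul, abs_of_pos hρ]
  have h1 : |g x| ≤ |C| * (1 + P.hamiltonian N x) ^ m * Real.exp (ϑ * P.hamiltonian N x) := by
    refine (hle x).trans ?_
    gcongr
    exact le_abs_self C
  have h2 : |C| * (1 + P.hamiltonian N x) ^ m * Real.exp (ϑ * P.hamiltonian N x) ≤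
      |C| * (K * Real.exp (s * P.hamiltonian N x)) * Real.exp (ϑ * P.hamiltonian N x) := by
    gcongr
  have h3 : |C| * (K * Real.exp (s * P.hamiltonian N x)) * Real.exp (ϑ * P.hamiltonian N x) =
      |C| * K * Real.exp ((ϑ + s) * P.hamiltonian N x) := by
    rw [add_mul, Real.exp_add]; ring
  calc |g x| * P.gibbsDensity N T x
      ≤ (|C| * K * Real.exp ((ϑ + s) * P.hamiltonian N x)) * P.gibbsDensity N T x := by
        refine mul_le_mul_of_nonneg_right ?_ hρ.le
        exact h1.trans (h2.trans h3.le)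
    _ = |C| * K * (Real.exp ((ϑ + s) * P.hamiltonian N x) * P.gibbsDensity N T x) := by ring

/-! ### Weighted integration by parts along a direction of phase space -/

/-- **Weighted integration by parts against `e^{-H/T}`.** Along a direction `v` with
`∂_v H = D = O((1+H)^{m_D})`: for `a = O((1+H)^m e^{θH})` with line derivative `a'` of the same
size and `g = O(e^{θH})` with line derivative `g'` of the same size, `θ < 1/(2T)`,
`∫ a g' ρ = -∫ a' g ρ + T⁻¹ ∫ D a g ρ` (`∂_v ρ = -(D/T) ρ`). [folklore] -/
theorem integral_mul_lineDeriv_mul_gibbsDensity (hω : 0 < ω₂) (hl : 0 ≤ lam) (hβ : 0 ≤ β)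
    (γ : ℝ) (N : ℕ) {T θ : ℝ} (hT : 0 < T) (hθ : θ < 1 / (2 * T))
    {v : PhaseSpace N} {D : PhaseSpace N → ℝ}
    (hD : ∀ x, HasLineDerivAt ℝ ((pinnedChain ω₂ lam β γ).hamiltonian N) (D x) x v)
    (hDc : Continuous D) {AD : ℝ} {mD : ℕ}
    (hDle : ∀ x, |D x| ≤ AD * (1 + (pinnedChain ω₂ lam β γ).hamiltonian N x) ^ mD)
    {a a' g g' : PhaseSpace N → ℝ} (ha : Continuous a) (ha' : Continuous a') (hg : Continuous g)
    (hg' : Continuous g') (had : ∀ x, HasLineDerivAt ℝ a (a' x) x v)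
    (hgd : ∀ x, HasLineDerivAt ℝ g (g' x) x v) {A C : ℝ} {m : ℕ}
    (hale : ∀ x, |a x| ≤ A * (1 + (pinnedChain ω₂ lam β γ).hamiltonian N x) ^ m *
      Real.exp (θ * (pinnedChain ω₂ lam β γ).hamiltonian N x))
    (ha'le : ∀ x, |a' x| ≤ A * (1 + (pinnedChain ω₂ lam β γ).hamiltonian N x) ^ m *
      Real.exp (θ * (pinnedChain ω₂ lam β γ).hamiltonian N x))
    (hgle : ∀ x, |g x| ≤ C * Real.exp (θ * (pinnedChain ω₂ lam β γ).hamiltonian N x))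
    (hg'le : ∀ x, |g' x| ≤ C * Real.exp (θ * (pinnedChain ω₂ lam β γ).hamiltonian N x)) :
    ∫ x, a x * g' x * (pinnedChain ω₂ lam β γ).gibbsDensity N T x =
      -(∫ x, a' x * g x * (pinnedChain ω₂ lam β γ).gibbsDensity N T x) +
        T⁻¹ * ∫ x, D x * a x * g x * (pinnedChain ω₂ lam β γ).gibbsDensity N T x := by
  set P := pinnedChain ω₂ lam β γ with hP
  have h2θ : 2 * θ < 1 / T := by
    have h := (lt_div_iff₀ (by positivity : (0:ℝ) < 2 * T)).mp hθ
    rw [lt_div_iff₀ hT]; linarith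
  have hρc : Continuous (P.gibbsDensity N T) := pinnedChain_continuous_gibbsDensity ω₂ lam β γ N T
  -- the four integrable products
  have i_a'g : Integrable fun x => a' x * g x * P.gibbsDensity N T x :=
    integrable_mul_gibbsDensity_of_le_exp hω hl hβ γ N hT h2θ m (ha'.mul hg)
      fun x => abs_mul_le_of_le_exp (ha'le x) (hgle x)
  have i_ag' : Integrable fun x => a x * g' x * P.gibbsDensity N T x :=
    integrable_mul_gibbsDensity_of_le_exp hω hl hβ γ N hT h2θ m (ha.mul hg')
      fun x => abs_mul_le_of_le_exp (hale x) (hg'le x)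
  have i_ag : Integrable fun x => a x * g x * P.gibbsDensity N T x :=
    integrable_mul_gibbsDensity_of_le_exp hω hl hβ γ N hT h2θ m (ha.mul hg)
      fun x => abs_mul_le_of_le_exp (hale x) (hgle x)
  have i_Dag : Integrable fun x => D x * a x * g x * P.gibbsDensity N T x :=
    integrable_mul_gibbsDensity_of_le_exp hω hl hβ γ N hT h2θ (mD + m) ((hDc.mul ha).mul hg)
      fun x => abs_mul_mul_le_of_le_exp (hDle x) (hale x) (hgle x)
  -- Mathlib's integration by parts with `F = a ρ`
  have e := integral_mul_eq_neg_of_hasLineDerivAt_of_integrable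
    (F := fun x => a x * P.gibbsDensity N T x)
    (F' := fun x => a' x * P.gibbsDensity N T x + a x * (-(D x / T) * P.gibbsDensity N T x))
    (g := g) (g' := g') (v := v) ?_ ?_ ?_ ?_ ?_
  · have lhs : ∫ x, a x * P.gibbsDensity N T x * g' x = ∫ x, a x * g' x * P.gibbsDensity N T x :=
      integral_congr_ae (Filter.Eventually.of_forall fun x => by simp only; ring)
    have rhs : ∫ x, (a' x * P.gibbsDensity N T x + a x * (-(D x / T) * P.gibbsDensity N T x)) * g x =
        (∫ x, a' x * g x * P.gibbsDensity N T x) -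
          T⁻¹ * ∫ x, D x * a x * g x * P.gibbsDensity N T x := by
      rw [← integral_const_mul, ← integral_sub i_a'g (i_Dag.const_mul _)]
      refine integral_congr_ae (Filter.Eventually.of_forall fun x => ?_)
      simp only
      ring
    rw [lhs, rhs] at e
    rw [e]
    ring
  · refine (i_a'g.sub (i_Dag.const_mul T⁻¹)).congr (Filter.Eventually.of_forall fun x => ?_)
    simp only [Pi.sub_apply]
    ring
  · exact i_ag'.congr (Filter.Eventually.of_forall fun x => by simp only; ring)
  · exact i_ag.congr (Filter.Eventually.of_forall fun x => by simp only; ring)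
  · intro x
    have hρ' := P.hasLineDerivAt_gibbsDensity (T := T) (hD x)
    exact hasLineDerivAt_mul (had x) hρ'
  · exact hgd

end Pinned

end Summit.AtomisticToContinuum.FouriersLaw.Theorems.ThomsonBound

end
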